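import Literature.NumberTheory.LFunctions.YoshidaWindowGramEnclosure
import HarnessLib

/-!
# rh-explicit (venture WeilGRH): PRIME-FREE WINDOWS — for `2a ≤ log 2` Yoshida's Gram matrix has NO prime term (weil-3 gen18)

Cell `rh-explicit`, WEIL TRACK (structure seat weil-3, gen18; WEIL3-STRUCTURE §26 «no prime needed»).  The windows `[−a, a]` with
`2a ≤ log 2` are exactly those whose Weil form sees no prime power: the prime index `{k : log k < 2a}` contains no prime power, so
`primeCoeff a n m = 0` and Yoshida's matrix coefficient is the POLE term plus the ARCHIMEDEAN (`ψ`, `ψ′`) term; and the prime data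
of such a window is the EMPTY list (`PrimeData a [] ↔ 2a ≤ log 2` for `a > 0`).  These are the structural facts behind the prime-free
rung `a = 693/2000` of the Christoffel certificates (`RigidityDataA03465` / `RigidityTableA03465`, where the same emptiness is certified
numerically by `checkPrimeDataSep`).  RH-free; no definitions; standard axioms; nothing here bears on the truth of RH.
-/

set_option linter.dupNamespace false
set_option autoImplicit false

namespace Summit.Ventures.WeilGRH.PrimeFree

open Literature.NumberTheory.LFunctions Literature.NumberTheory.LFunctions.Yoshida1992

/-- A prime power has logarithm at least `log 2`. -/
theorem log_two_le_log_of_isPrimePow {k : ℕ} (hk : IsPrimePow k) : Real.log 2 ≤ Real.log k :=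
  Real.log_le_log (by norm_num) (by exact_mod_cast hk.two_le)

/-- In a prime-free window (`2a ≤ log 2`) every member of the prime index `{k : log k < 2a}` is `0` or `1`, hence has `Λ k = 0`. -/
theorem vonMangoldt_eq_zero_of_mem_weilPrimeIndex {a : ℝ} (h : 2 * a ≤ Real.log 2) {k : ℕ}
    (hk : k ∈ weilPrimeIndex a) : (ArithmeticFunction.vonMangoldt k : ℝ) = 0 := by
  rw [ArithmeticFunction.vonMangoldt_eq_zero_iff]
  intro hpp
  have hlt : Real.log k < 2 * a := mem_weilPrimeIndex.1 hk
  exact absurd (lt_of_lt_of_le hlt h) (not_lt.2 (log_two_le_log_of_isPrimePow hpp))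

/-- ★ **No prime term in a prime-free window**: for `2a ≤ log 2`, `primeCoeff a n m = 0` for all modes `n, m`. -/
theorem primeCoeff_eq_zero {a : ℝ} (h : 2 * a ≤ Real.log 2) (n m : ℤ) : primeCoeff a n m = 0 := by
  unfold primeCoeff
  refine Finset.sum_eq_zero fun k hk ↦ ?_
  rw [vonMangoldt_eq_zero_of_mem_weilPrimeIndex h hk, zero_div, zero_mul]

/-- ★ **Yoshida's matrix of a prime-free window is pole + archimedean**: for `2a ≤ log 2`,
`gramCoeff a n m = polarCoeff a n m + archCoeff a n m`. -/
theorem gramCoeff_eq_polar_add_arch {a : ℝ} (h : 2 * a ≤ Real.log 2) (n m : ℤ) :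
    gramCoeff a n m = polarCoeff a n m + archCoeff a n m := by
  rw [gramCoeff, primeCoeff_eq_zero h, add_zero]

/-- The prime data of a prime-free window is the empty list. -/
theorem primeData_nil {a : ℝ} (h : 2 * a ≤ Real.log 2) : PrimeData a [] := by
  refine ⟨fun q hq ↦ (List.not_mem_nil hq).elim, by simp, fun k hk ↦ ?_⟩
  simp only [List.map_nil, List.not_mem_nil, iff_false]
  intro hmem
  have hlt : Real.log k < 2 * a := mem_weilPrimeIndex.1 hmem
  exact absurd (lt_of_lt_of_le hlt h) (not_lt.2 (log_two_le_log_of_isPrimePow hk))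

/-- ★ **Characterisation of the prime-free windows**: for `a > 0`, the prime data of `[−a, a]` is empty iff `2a ≤ log 2`
(the prime `2` is the first prime power to enter, at `a = (log 2)/2`). -/
theorem primeData_nil_iff {a : ℝ} (_ha : 0 < a) : PrimeData a [] ↔ 2 * a ≤ Real.log 2 := by
  refine ⟨fun hP ↦ ?_, primeData_nil⟩
  by_contra hlt
  rw [not_le] at hlt
  have h2 : (2 : ℕ) ∈ weilPrimeIndex a := mem_weilPrimeIndex.2 (by exact_mod_cast hlt)
  have := (hP.mem_iff 2 (Nat.prime_two.isPrimePow)).1 h2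
  simp at this

/-- The rung `a = 693/2000` of the Christoffel certificates is prime-free: `2 · 693/2000 = 0.693 < log 2`. -/
theorem two_mul_A03465_le_log_two : 2 * ((693 : ℝ) / 2000) ≤ Real.log 2 := by
  have h : (0.6931471803 : ℝ) < Real.log 2 := Real.log_two_gt_d9
  norm_num at h ⊢
  linarith

/-- Hence Yoshida's matrix at `a = 693/2000` is pole + archimedean, with empty prime data. -/
theorem gramCoeff_A03465 (n m : ℤ) :
    gramCoeff ((693 : ℝ) / 2000) n m = polarCoeff ((693 : ℝ) / 2000) n m + archCoeff ((693 : ℝ) / 2000) n m :=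
  gramCoeff_eq_polar_add_arch two_mul_A03465_le_log_two n m

end Summit.Ventures.WeilGRH.PrimeFree
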